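import Mathlib
import HarnessLib
import Summits.Langlands.Langlands.Theses.SkinnerWilesDefectOne
import Summits.Langlands.Langlands.Theorems.ProModularOrdinaryClassical.Negative.LoadBearing
import Literature.NumberTheory.Automorphic.OrdinaryCompletedCohomologyGL
import Literature.NumberTheory.Automorphic.IsAutomorphicAE
import Literature.NumberTheory.GaloisRepresentations.ResidualGaloisRep
import Literature.NumberTheory.GaloisRepresentations.EnormousSubgroup
import Literature.NumberTheory.GaloisRepresentations.DecomposedGeneric

/-!
# Line `ordinary-patching-by-regime` for the crux `SkinnerWilesDefectOne.ProModularOrdinaryClassical`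
(stmt-Langlands-12921, THE EXIT of route `SkinnerWilesDefectOne`; crux-plan round 1; idea card
`Ideas/ordinary-patching-by-regime.md` (ideator 3), triage `TRIAGE-r1-{1,2,3}.md`: pass ×3 with sharpenings).

**The crux.** `F` imaginary quadratic, `p` odd, `ρ : Γ_F → GL₂(ℚ̄_p)` irreducible, a.e. unramified,
PRO-MODULAR (`ProMod`: a continuous `ℚ̄_p`-point of the FULL completed-cohomology Hecke algebra `𝕋(𝒰)` of
the Bianchi tower — spherical operators only) and ORDINARY of one parallel weight `k ≥ 2` with exponent
`m > 0` at every `v ∣ p` (`OrdParallel`) ⟹ CLASSICAL (`CruxConclusion`: an L-algebraic cuspidal `π` of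
`GL₂(𝔸_F)` with Satake–Frobenius matching a.e.; definitionally `IsAutomorphicAE ι hcpt ρ`,
`cruxConclusion_iff_isAutomorphicAE`). `crux_iff : ProModularOrdinaryClassical ↔ ∀ …, ProMod p ρ →
OrdParallel p ρ → CruxConclusion p hcpt ι ρ := Iff.rfl` certifies the cut is the crux VERBATIM.

**Lever (card).** The object is Hida's ORDINARY completed cohomology `e·H̃(𝒰)` of the Bianchi Hida tower with
its big ordinary Hecke algebra `𝕋^{S,ord}(𝒰) = OrdinaryHeckeAlgebraGLn 𝒰` (tree, constructed) over the
Iwasawa algebra of `T₂(𝒪_{F,p})` (diamonds `ordDiamondHom`).  The TRANSFER is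
`C⁺ = OrdProMod p ρ := ∃ 𝒰, 𝒰.IsMaximalAbove ∧ 𝒰.IsOrdinarilyPadicallyAutomorphic ρ` (the route's foreseen
`OrdinaryFactorisation`): `ρ` is a point of `𝕋^{S,ord}`, after which classicality is Hida–Khare–Thorne
control in the ordinary degrees + the weight character at the point + Eichler–Shimura–Harder
(`stub_classicalOfOrdinaryPoint`).  Pro-modularity is spent ONLY on making the residual eigensystem
ordinarily automorphic (`stub_ordinaryOccurrence`: `ProMod ∧ OrdParallel ⟹ ResOrdOccurs`, the ordinary
Serre-weight statement for Bianchi groups INCLUDING torsion `𝔪` — triage r1-1/r1-2 sharpening: stub #1,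
load-bearing in every regime), and the Galois ⟹ Hecke step is split by the RESIDUAL REGIME of `ρ̄`
(the crux has no residual hypothesis):

* (R1) `EnormousRegime p ρ` — `ρ̄` absolutely irreducible, decomposed generic, `ρ̄(Γ_{F(ζ_p)})` enormous,
  some `ρ̄(σ)` scalar off `Γ_{F(ζ_p)}`: the hypotheses (iii)–(iv) of ACCGHLNSTT2023 Thm 6.1.2 typed VERBATIM
  (as in the tree's `Qian2022.potentialAutomorphy_ordinary`).  Here the line is: `ResOrdOccurs` ⟹ a
  CLASSICAL ι-ordinary cuspidal lift of `ρ̄` (`stub_classicalOrdinarySeed`, triage r1-2/r1-3 sharpening: the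
  second open half of "ResidualOrdinaryOccurrence", NOT given by Hida control at `l₀ = 1` because `𝕋^{ord}_𝔪`
  is `Λ`-torsion, CalegariMazur2008) ⟹ ACC+ Thm 6.1.2 as printed + normalisation bookkeeping
  (`stub_enormousOrdinaryLift`).  On R1 ∩ {classical ordinary seed} the crux is thereby A THEOREM IN PRINT.
* (R2) `ρ̄` absolutely irreducible but not R1-generic (`stub_smallImageFactorisation`): Calegari–Geraghty /
  Khare–Thorne patching of the two-term ORDINARY complexes (degrees `q₀ = 1`, `q₀ + l₀ = 2`) over `Λ_F` with
  Taylor–Wiles primes chosen relative to `ρ mod p^N` (Thorne 2015 / Allen–Newton–Thorne 2020) — UNBUILT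
  anywhere at defect one (card and all three triagers); registered as the honest bet of the card.
* (R3) `ρ̄` reducible (`stub_reducibleRegimeFactorisation`): Skinner–Wiles nice primes over `Λ_F` inside the
  same ordinary complexes = the ENGINE crux `ReducibleOrdinaryProModular` (stmt-Langlands-12919) run with
  nearly-ordinary output (uniform orientation), Berger–Klosin 2013 + extensions (mixed orientation).  Triage
  r1-3 (b): "not a line for THIS crux" on its own — registered so that the skeleton concludes the crux BY NAME
  for every `ρ`; do not staff it from this line before the engine moves.
Both (R2) and (R3) conclude the transfer `C⁺`, consumed by `stub_classicalOfOrdinaryPoint` (shared verbatim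
with the sibling idea `top-degree-exact-control`'s `OrdinaryPointsClassical`).

**Composition.** `ProModularOrdinaryClassical_of : S1 → S2 → S3 → S4 → S5 → S6 → ProModularOrdinaryClassical`
is kernel-checked pure logic: `ResOrdOccurs` from S1; `by_cases ρ.IsResiduallyAbsIrreducible`;
`by_cases EnormousRegime p ρ`; R1 ↦ S3 ∘ S2, R2 ↦ S6 ∘ S5, R3 ↦ S6 ∘ S4.  Sorries live only in `stub_*`.

**Disproof used.** `Cruxes/ProModularOrdinaryClassical/Disproof.lean` (cdisprove gen 1, cycle 1) has NO
`¬`-theorem and NO `_false_without_<H>` theorem (`crux_of_ordinaryFontaineMazur`: no kill short of ¬FM(B)).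
Honoured: §0 (`hpm` is the only lever) — `ProMod` is consumed by `stub_ordinaryOccurrence` (and offered to
S2/S4/S5), so on R1 the line is, as §0 predicts for any `hpm`-light proof, FM on {R1 ∩ seeded}, which is ACC+;
§1c (`0 < m` load-bearing) — `OrdParallel` keeps `0 < m` and is passed to S1–S3, S4–S6 (arithmetic weight);
§1e (irreducibility load-bearing) — passed to every stub (cuspidality; excludes the `H⁰`/Eisenstein point
`ε ⊕ 1`); §1a (`hunr` decoration) — passed only to S3 (ACC+ lists it); S6 is stated without it, textually equal to
the sibling line `paskunas-centre-split`'s stub of the same name; §2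
(`WithPerPlaceWeights`) — not claimed.  The LANDED negative file
`Theorems/ProModularOrdinaryClassical/Negative/LoadBearing.lean` is IMPORTED here (scratch check): none of its
lemmas (`eventually_isUnramifiedAt_of_isPadicallyAutomorphic`, `exists_uniform_exponent`,
`isOrdinaryOfWeight_exponent_zero_iff`, …) refutes an instance of any stub (no stub drops `0 < m`, `2 ≤ k` or
irreducibility).  Negatives index (`ledger negatives --problem Langlands`): 1 unrelated entry (K3 anchor).

Conventions: the tree's (homological, arithmetic-Frobenius) normalisation throughout — `ρ` for an ordinary
weight-`k` form has SUB `~ ε^{k-1}` on inertia (`IsOrdinaryOfWeightAt`, Skinner–Wiles shape); ACC+'s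
`r_ι(π)` is cohomological with INCREASING inertial exponents down the diagonal, i.e. `ρ ⊗ ε^{1-k}` is
ACC+-ordinary of weight `λ = (k-2, 0)`; the twists are bookkeeping inside `stub_enormousOrdinaryLift`.
-/

namespace Summit.Langlands.Langlands.Cruxes.ProModularOrdinaryClassical.OrdinaryPatchingByRegime

set_option linter.dupNamespace false
set_option linter.unusedVariables false

open scoped NumberField MatrixGroups
open Filter NumberField IsDedekindDomain Field
open Literature.NumberTheory.Automorphic Literature.NumberTheory.Automorphic.BigHeckeGLn
open Literature.NumberTheory.GaloisRepresentations
open Summit.Langlands.Langlands.Theses.SkinnerWilesDefectOne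

noncomputable section

/-! ## 0. Vocabulary: the crux cut into hypotheses / conclusion, the transfer `C⁺`, the regimes -/

variable {F : Type} [Field F] [NumberField F] (p : ℕ) [Fact p.Prime]

/-- H3 of the crux, verbatim: `ρ` is **pro-modular** (`p`-adically automorphic of some tame level):
associated with a continuous `ℚ̄_p`-point of the FULL completed-cohomology Hecke algebra `𝕋(𝒰)` of the
Bianchi tower (spherical operators `T_{w,j}`, `w ∉ S`, only). -/
def ProMod (ρ : FramedGaloisRep F (PadicAlgCl p) 2) : Prop :=
  ∃ 𝒰 : TameLevel 2 F p, 𝒰.IsPadicallyAutomorphic ρ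

/-- H4 of the crux, verbatim: `ρ` is **ordinary of ONE parallel weight `k ≥ 2`** with a positive inertial
exponent `m` at every place `v ∣ p` (Skinner–Wiles shape: sub `θ₁` with `θ₁^m = ε^{(k-1)m}`, quotient `θ₂`
with `θ₂^m = 1` on inertia). `0 < m` and `2 ≤ k` are load-bearing (Disproof §1c, §1d). -/
def OrdParallel (ρ : FramedGaloisRep F (PadicAlgCl p) 2) : Prop :=
  ∃ k : ℕ, 2 ≤ k ∧ ∃ m : ℕ, 0 < m ∧ ∀ v : HeightOneSpectrum (𝓞 F), (p : 𝓞 F) ∈ v.asIdeal →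
    ρ.IsOrdinaryOfWeightAt p v k m

/-- The crux's conclusion, verbatim: `ρ` is **classical** — an L-algebraic cuspidal `π` on `GL₂(𝔸_F)`
with Satake–Frobenius matching at almost all places. Definitionally `IsAutomorphicAE ι hcpt ρ`
(`cruxConclusion_iff_isAutomorphicAE`). -/
def CruxConclusion (hcpt : isCompact_glFiniteIntegralLevel 2 F) (ι : PadicAlgCl p ≃+* ℂ)
    (ρ : FramedGaloisRep F (PadicAlgCl p) 2) : Prop :=
  ∃ π : CuspidalAutomorphicRepData 2 F hcpt, π.1.IsLAlgebraic ∧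
    ∀ᶠ v in cofinite, Summit.Langlands.SatakeFrobCompatibleAt ι π.1 ρ v

/-- **The transfer `C⁺` (`OrdinaryFactorisation` target): `ρ` is ORDINARILY pro-modular** — associated with
a continuous `ℚ̄_p`-point of Hida's ordinary big Hecke algebra `𝕋^{S,ord}(𝒰) = OrdinaryHeckeAlgebraGLn 𝒰`
of a tame level maximal above `p` (the Hida tower `U(r)`, Khare–Thorne's `U(c,c)`). Easier than the crux
because it concerns ONE finite-type `Λ_F`-module `e·H̃` carrying `U_v` and the diamonds (card, Transfer). -/
def OrdProMod (ρ : FramedGaloisRep F (PadicAlgCl p) 2) : Prop :=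
  ∃ 𝒰 : TameLevel 2 F p, 𝒰.IsMaximalAbove ∧ 𝒰.IsOrdinarilyPadicallyAutomorphic ρ

/-- **Residual ordinary occurrence** ("`𝔪 ∈ Supp e·H̃`", half (a) of the card's `ResidualOrdinaryOccurrence`):
a residual representation `τ = ρ̄ ⊗_ι k` of `ρ` over a discrete field `k ⊇ ℤ̄_p/𝔪` is ORDINARILY
`p`-adically automorphic of some tame level maximal above `p` — i.e. `τ` is associated with a continuous
`k`-valued eigensystem of `𝕋^{S,ord}(𝒰)` (the residual eigensystem of a maximal ideal of Hida's ordinary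
Hecke algebra). Typed like the tree's `TameLevel.IsResidualRepAt`/`IsNonEisenstein`. -/
def ResOrdOccurs (ρ : FramedGaloisRep F (PadicAlgCl p) 2) : Prop :=
  ∃ (𝒰 : TameLevel 2 F p) (k : Type) (_ : Field k) (_ : TopologicalSpace k) (_ : DiscreteTopology k)
    (ιk : padicAlgClResidueField p →+* k) (τ : FramedGaloisRep F k 2),
    𝒰.IsMaximalAbove ∧ ρ.IsResidualRepOf ιk (τ : absoluteGaloisGroup F →* GL (Fin 2) k) ∧
      𝒰.IsOrdinarilyPadicallyAutomorphic τ

/-- **Regime R1 (`ρ̄` Taylor–Wiles-generic in the sense of ACCGHLNSTT2023 Thm 6.1.2 (iii)–(iv), VERBATIM as in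
the tree's `Qian2022.potentialAutomorphy_ordinary`)**: some residual representation `τ : Γ_F → GL₂(ℤ̄_p/𝔪)` of
`ρ` is absolutely irreducible and decomposed generic (ACC+ Def. 4.3.1), `τ|_{Γ_{F(ζ_p)}}` is absolutely
irreducible with enormous image (ACC+ Def. 6.2.28), and `τ σ` is scalar for some `σ ∉ Γ_{F(ζ_p)}`.  All four
conditions are invariant under conjugation and under twisting by powers of the mod-`p` cyclotomic character
(the homological/cohomological dictionary), so "some `τ`" is the printed hypothesis; `p > n = 2` is the
crux's `p ≠ 2`. -/
def EnormousRegime (ρ : FramedGaloisRep F (PadicAlgCl p) 2) : Prop :=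
  ∃ τ : absoluteGaloisGroup F →* GL (Fin 2) (padicAlgClResidueField p),
    ρ.IsResidualRepOf (RingHom.id _) τ ∧ IsAbsIrreducible τ ∧ IsDecomposedGeneric τ ∧
      IsAbsIrreducible (τ.comp (absGaloisGroupAdjoinRootsOfUnity F p).subtype) ∧
      Subgroup.IsEnormous ((absGaloisGroupAdjoinRootsOfUnity F p).map τ) ∧
      ∃ σ : absoluteGaloisGroup F, σ ∉ absGaloisGroupAdjoinRootsOfUnity F p ∧
        ∃ c : padicAlgClResidueField p,
          ((τ σ : GL (Fin 2) (padicAlgClResidueField p)) :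
            Matrix (Fin 2) (Fin 2) (padicAlgClResidueField p)) =
            c • (1 : Matrix (Fin 2) (Fin 2) (padicAlgClResidueField p))

/-- **A classical ordinary seed for `ρ̄`** (ACC+ Thm 6.1.2 hypothesis (v), GALOIS-side in the tree's
normalisation; half (b) of the card's `ResidualOrdinaryOccurrence`): a CHARACTERISTIC-ZERO `r₀ : Γ_F → GL₂(ℚ̄_p)`
which is classical (`IsAutomorphicAE ι hcpt r₀`: attached a.e. to an L-algebraic CUSPIDAL `π₀`), ordinary of
some parallel weight `k₀ ≥ 2` at every `v ∣ p` (`OrdParallel`), ordinarily pro-modular (`OrdProMod`: the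
`p`-stabilised `π₀` is a point of `𝕋^{S,ord}` — offered so that ι-ordinarity of `π₀` can be read on either
side), and residually equal to `ρ` (a common residual representation over `ℤ̄_p/𝔪`). -/
def ClassicalOrdSeed (hcpt : isCompact_glFiniteIntegralLevel 2 F) (ι : PadicAlgCl p ≃+* ℂ)
    (ρ : FramedGaloisRep F (PadicAlgCl p) 2) : Prop :=
  ∃ r₀ : FramedGaloisRep F (PadicAlgCl p) 2,
    IsAutomorphicAE ι hcpt r₀ ∧ OrdParallel p r₀ ∧ OrdProMod p r₀ ∧
      ∃ τ : absoluteGaloisGroup F →* GL (Fin 2) (padicAlgClResidueField p),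
        ρ.IsResidualRepOf (RingHom.id _) τ ∧ r₀.IsResidualRepOf (RingHom.id _) τ

/-! ## 1. Certificates: the cut is the crux verbatim; the conclusion is Literature's `IsAutomorphicAE` -/

/-- The crux, re-read through the vocabulary above: definitional (`Iff.rfl`). -/
theorem crux_iff :
    Summit.Langlands.Langlands.Theses.SkinnerWilesDefectOne.ProModularOrdinaryClassical ↔
      ∀ (F : Type) [Field F] [NumberField F], IsTotallyComplex F → Module.finrank ℚ F = 2 →
        ∀ (p : ℕ) [Fact p.Prime], p ≠ 2 →
        ∀ (hcpt : isCompact_glFiniteIntegralLevel 2 F) (ι : PadicAlgCl p ≃+* ℂ)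
          (ρ : FramedGaloisRep F (PadicAlgCl p) 2),
          ρ.toGaloisRep.IsIrreducible → (∀ᶠ v in cofinite, ρ.IsUnramifiedAt v) →
            ProMod p ρ → OrdParallel p ρ → CruxConclusion p hcpt ι ρ :=
  Iff.rfl

/-- The crux's conclusion IS the tree's almost-everywhere automorphy predicate (`IsAutomorphicAE`,
`Literature/NumberTheory/Automorphic/IsAutomorphicAE.lean`): definitional. -/
theorem cruxConclusion_iff_isAutomorphicAE (hcpt : isCompact_glFiniteIntegralLevel 2 F)
    (ι : PadicAlgCl p ≃+* ℂ) (ρ : FramedGaloisRep F (PadicAlgCl p) 2) :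
    CruxConclusion p hcpt ι ρ ↔ IsAutomorphicAE ι hcpt ρ :=
  Iff.rfl

/-- Bookkeeping: the enormous regime supplies an absolutely irreducible residual representation of `ρ`
(first two clauses).  (That this implies `ρ.IsResiduallyAbsIrreducible` — descent of a semisimplified
reduction to a reduction — is left to the stubs; the composition below cases on both predicates and never
needs the implication.) -/
theorem enormousRegime_isAbsIrreducible {ρ : FramedGaloisRep F (PadicAlgCl p) 2}
    (h : EnormousRegime p ρ) :
    ∃ τ : absoluteGaloisGroup F →* GL (Fin 2) (padicAlgClResidueField p),
      ρ.IsResidualRepOf (RingHom.id _) τ ∧ IsAbsIrreducible τ := by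
  obtain ⟨τ, hres, hirr, -⟩ := h
  exact ⟨τ, hres, hirr⟩

/-! ## 2. The six stubs (registered; `sorry` only here) -/

/-- **Stub S1 `stub_ordinaryOccurrence` — residual ORDINARY occurrence (the ordinary Serre-weight statement
for Bianchi groups, torsion `𝔪` included; uses `hpm`; ALL regimes; triage r1-1 "stub #1", r1-2 half (a)).**
For `F` imaginary quadratic, `p` odd, `ρ` irreducible, pro-modular and Galois-ordinary of a parallel weight
`k ≥ 2` (`m > 0`): some residual representation of `ρ` is ordinarily `p`-adically automorphic of a tame level
maximal above `p` (`ResOrdOccurs`: the residual eigensystem `𝔪 = x̄` of the point `x` of `𝕋(𝒰)` attached to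
`ρ` occurs in Hida's ordinary completed cohomology `e·H̃(𝒰')`).  Why plausibly true: continuity of `x` puts
`𝔪` in `Supp H^•(X_{U_r}, 𝔽_p)`; dévissage to Iwahori level and Serre weights; the Galois-ordinary shape of
`ρ̄|_{Γ_{F_v}} = (ψ̄₁ω^{k-1} ∗; 0 ψ̄₂)` predicts (Gee–Herzig–Savitt / BDJ-type weight conjectures) that the
ordinary weight `σ_{k,ψ}` lies in `W(𝔪)`, i.e. `U_v` acts invertibly on the `𝔪`-part in that weight.  Why it
might fail / what is open: weight elimination and ordinary weight EXISTENCE for torsion Bianchi classes need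
torsion local–global compatibility at `p` with `F⁺ = ℚ` having ONE place above `p` (crux NOTES B1; CN23
Thm 4.2.15 hyp. (1)); residual-shape coincidence (NegativeNotes B4).  Size XL.
Sources: arXiv:2301.10509 (Thm 4.2.15), arXiv:1812.09999 §5, Gee–Herzig–Savitt (JEMS 2018),
Calegari–Geraghty 2018 §1, KhareThorne2017 §6. -/
theorem stub_ordinaryOccurrence :
    ∀ (F : Type) [Field F] [NumberField F], IsTotallyComplex F → Module.finrank ℚ F = 2 →
      ∀ (p : ℕ) [Fact p.Prime], p ≠ 2 →
      ∀ (ρ : FramedGaloisRep F (PadicAlgCl p) 2),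
        ρ.toGaloisRep.IsIrreducible → ProMod p ρ → OrdParallel p ρ → ResOrdOccurs p ρ := by
  sorry

/-- **Stub S2 `stub_classicalOrdinarySeed` — a CLASSICAL ι-ordinary cuspidal lift of `ρ̄` in regime R1
(triage r1-2 half (b) / r1-3 (a): "a residual torsion ⇒ classical statement one level down"; uses `hpm`
through S1's output and is offered `ρ` itself as a characteristic-0 ordinary pro-modular lift).**
For `F` imaginary quadratic, `p` odd, `ρ` irreducible, pro-modular, Galois-ordinary of parallel weight, with
`ρ̄` in the enormous regime and ordinarily occurring residually: there is a classical `r₀` (L-algebraic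
cuspidal `π₀`, a.e. Satake matching), ordinary of some parallel weight `k₀ ≥ 2`, ordinarily pro-modular, with
the same residual representation as `ρ` (`ClassicalOrdSeed`).  Why plausibly true: predicted by FM (applied to
`ρ`!) and, independently of `ρ`, by Fakhruddin–Khare–Patrikis geometric ordinary lifting + FM; automorphic
route: the component of `Spec 𝕋^{S,ord}(𝒰')_𝔪` through the residual point acquires, after enlarging the tame
level, a characteristic-0 point of dominant arithmetic parallel weight (Khare–Thorne-type codimension-`l₀`
statements for ordinary cohomology concentrated in degrees `[q₀, q₀+l₀]`; ordinary level raising), classical by S6-type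
control, with Galois representation `r₀` ordinary by the KNOWN direction Hecke-ordinary ⇒ Galois-ordinary for
classical Bianchi `π₀` (CN23 Thm 4.2.15 (ord) via cyclic base change; Hevesi arXiv:2311.13514).  Why it might
fail: at `l₀ = 1` the localised Hida family is `Λ_F`-torsion (CalegariMazur2008) and may miss every parallel
arithmetic weight at the given level; no level-raising theorem for ordinary torsion Bianchi classes is in
print.  NOT given by Hida/KT control alone (triage r1-3 (a)).  Size XL (hardest genuinely-new stub of R1).
Sources: CalegariMazur2008 (JIMJ 2009), KhareThorne2017 §6, arXiv:1812.09999 §§5–6, FKP (Duke 2021),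
arXiv:2301.10509. -/
theorem stub_classicalOrdinarySeed :
    ∀ (F : Type) [Field F] [NumberField F], IsTotallyComplex F → Module.finrank ℚ F = 2 →
      ∀ (p : ℕ) [Fact p.Prime], p ≠ 2 →
      ∀ (hcpt : isCompact_glFiniteIntegralLevel 2 F) (ι : PadicAlgCl p ≃+* ℂ)
        (ρ : FramedGaloisRep F (PadicAlgCl p) 2),
        ρ.toGaloisRep.IsIrreducible → ProMod p ρ → OrdParallel p ρ →
          EnormousRegime p ρ → ResOrdOccurs p ρ → ClassicalOrdSeed p hcpt ι ρ := by
  sorry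

/-- **Stub S3 `stub_enormousOrdinaryLift` — ACCGHLNSTT2023 Theorem 6.1.2 (arXiv:1812.09999 p. 64,
"Theorem 72") transposed to the tree's normalisation (regime R1; a THEOREM IN PRINT plus bookkeeping; does
NOT use `hpm`, consistent with Disproof §0).**  Printed hypotheses ↔ ours: (i) unramified a.e. ↔ `hunr`;
(ii) potentially semistable, ordinary with regular Hodge–Tate weights ↔ `OrdParallel p ρ` after the twist
`ρ ⊗ ε^{1-k}` (ACC+ shape: inertial exponents increasing down the diagonal, weight `λ = (k-2, 0)`, regular as
`k ≥ 2`; `0 < m` makes the diagonal characters agree with algebraic ones on an OPEN subgroup of inertia);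
(iii)–(iv) ↔ `EnormousRegime p ρ` (twist-invariant), `p > n = 2` ↔ `p ≠ 2`; (v) "a regular algebraic
cuspidal ι-ordinary `π` with `r̄_ι(π) ≅ ρ̄`" ↔ `ClassicalOrdSeed` (from `r₀`: `π := ` the C-algebraic twist of
`π₀` by `|det|^{1/2}` and by a Teichmüller power matching `ω^{k₀-k}`; ι-ordinarity of `π` from `OrdProMod p r₀`
(classical ordinary `p`-stabilisation) or from Galois-ordinarity of `r₀` by semisimple local–global
compatibility at `p` for classical Bianchi `π₀`).  Conclusion "ρ ⊗ ε^{1-k} ≅ r_ι(Π), `Π` ι-ordinary cuspidal of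
weight ιλ" ⟹ `CruxConclusion` by the C/L-algebraic half-twist and the homological/cohomological dictionary
(`SatakeFrobCompatibleAt` uses the ARITHMETIC Frobenius and `arithFrobPolyOfSatake ι q 1 α`).  Why it might
fail: only the bookkeeping (signs of twists; ι-ordinarity of the seed) — the theorem itself is printed for
"`F` an imaginary CM or totally real field", any `p > n`.  Size L (vendoring Thm 6.1.2 as a named fact with the
automorphic notion "ι-ordinary of weight λ" is most of the work).
Sources: arXiv:1812.09999 Thm 6.1.2 + Remark 6.1.3 (= Rem. 73: "what we in fact prove is that ρ contributes
to the ordinary part of the completed cohomology"), Def. 4.3.1, Def. 6.2.28; Geraghty 2019 (ordinary lifting);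
BuzzardGeeLMS2014 §§3, 8 (C/L twist). -/
theorem stub_enormousOrdinaryLift :
    ∀ (F : Type) [Field F] [NumberField F], IsTotallyComplex F → Module.finrank ℚ F = 2 →
      ∀ (p : ℕ) [Fact p.Prime], p ≠ 2 →
      ∀ (hcpt : isCompact_glFiniteIntegralLevel 2 F) (ι : PadicAlgCl p ≃+* ℂ)
        (ρ : FramedGaloisRep F (PadicAlgCl p) 2),
        ρ.toGaloisRep.IsIrreducible → (∀ᶠ v in cofinite, ρ.IsUnramifiedAt v) → OrdParallel p ρ →
          EnormousRegime p ρ → ClassicalOrdSeed p hcpt ι ρ → CruxConclusion p hcpt ι ρ := by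
  sorry

/-- **Stub S4 `stub_reducibleRegimeFactorisation` — regime R3 (`ρ̄` reducible): the transfer `C⁺` by
Skinner–Wiles nice primes over `Λ_F` inside the Khare–Thorne ordinary complexes.**  For `F` imaginary
quadratic, `p` odd, `ρ` irreducible, pro-modular, Galois-ordinary of parallel weight, NOT residually absolutely
irreducible, with residual ordinary occurrence: `ρ` is ordinarily pro-modular (`OrdProMod`).  This is the
ENGINE crux `ReducibleOrdinaryProModular` (stmt-Langlands-12919) run with nearly-ordinary output in the
uniform (Skinner–Wiles) orientation — its own mechanism (patching the `P`-ordinary two-term complexes at a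
dimension-one nice prime of the nearly ordinary deformation ring over `Λ_F`) lands in `𝕋^{n.o.}`, not merely
in `𝕋` (crux NOTES §3, NegativeNotes B0) — and Berger–Klosin 2009/2013 (+ Akers 2025; extensions: Klosin's Ihara
lemma, Iyengar–Khare–Manning) in the mixed orientation at split `p` (card R3m; sibling idea
`reducibility-ideal-elliptic-units`).  HONEST LABEL (triage r1-1, r1-3 (b)): no content independent of the
engine for the route's own population; registered so that the composition concludes the crux BY NAME on R3;
not to be staffed from this line before stmt-Langlands-12919 moves.  Note `ResOrdOccurs` is weak here
(boundary/Eisenstein ordinary systems realise reducible `ρ̄` cheaply); `ProMod` and the engine's Eisenstein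
congruences carry the load.  Why it might fail: the engine's own why-might-fail (dim `R^{red} ≤ 3` nakedly
over `F`, `μ > 0`, Raynaud over `Λ_F`) plus ordinary torsion LGC at an Eisenstein `𝔪`.  Size XL.
Sources: SkinnerWiles1999 §§3–4, CalegariGeraghty2017 §§5, 8, KhareThorne2017, arXiv:0801.0091,
arXiv:1103.5100, doi:10.1142/s1793042125500228, arXiv:2206.08212. -/
theorem stub_reducibleRegimeFactorisation :
    ∀ (F : Type) [Field F] [NumberField F], IsTotallyComplex F → Module.finrank ℚ F = 2 →
      ∀ (p : ℕ) [Fact p.Prime], p ≠ 2 →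
      ∀ (ρ : FramedGaloisRep F (PadicAlgCl p) 2),
        ρ.toGaloisRep.IsIrreducible → ProMod p ρ → OrdParallel p ρ →
          ¬ ρ.IsResiduallyAbsIrreducible → ResOrdOccurs p ρ → OrdProMod p ρ := by
  sorry

/-- **Stub S5 `stub_smallImageFactorisation` — regime R2 (`ρ̄` absolutely irreducible, not R1-generic): the
transfer `C⁺` by ordinary patching at defect one with Taylor–Wiles primes chosen modulo `p^N`.**  For `F`
imaginary quadratic, `p` odd, `ρ` irreducible, pro-modular, Galois-ordinary of parallel weight, residually
absolutely irreducible but outside `EnormousRegime`, with residual ordinary occurrence: `ρ` is ordinarily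
pro-modular.  Mechanism (card R2): `R^{ord}_𝒮 ↠ 𝕋^{ord}_𝔪` with nilpotent kernel on the component through `ρ`
by Calegari–Geraghty / Khare–Thorne patching of the two-term ORDINARY complexes over `Λ_F` (homology in
degrees `q₀ = 1`, `q₀ + l₀ = 2`; Geraghty's local ring `R^△_v` at `v ∣ p`, split AND inert `p`), the
auxiliary primes chosen relative to `ρ mod p^N` (Thorne, JAMS 28 (2015); Allen–Newton–Thorne 2020 II: largeness
of `ρ(Γ_F) mod p^N` replaces adequacy of `ρ̄`); then every Galois-ordinary lift of `ρ̄_𝔪` of parallel weight,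
in particular `ρ_x`, is a point of `𝕋^{ord}`.  HONEST LABEL (card; triage ×3): UNBUILT anywhere at positive
defect (ANT20 is polarized, defect 0); needs torsion Hecke⇒Galois LGC with diamonds for the `𝕋^{ord}_𝔪`-valued
determinant at the single place of `F⁺ = ℚ` above `p` (triage r1-3 (c)); the dihedral / `p ≤ 5` exceptional
images are included in this regime.  Size XL (the card's bet).
Sources: CalegariGeraghty2017, KhareThorne2017 §§2.4, 6, Hansen2012, Thorne2015JAMS, AllenNewtonThorne2020,
GeeNewton2020 (arXiv:1609.06965), arXiv:1812.09999 §6.5. -/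
theorem stub_smallImageFactorisation :
    ∀ (F : Type) [Field F] [NumberField F], IsTotallyComplex F → Module.finrank ℚ F = 2 →
      ∀ (p : ℕ) [Fact p.Prime], p ≠ 2 →
      ∀ (ρ : FramedGaloisRep F (PadicAlgCl p) 2),
        ρ.toGaloisRep.IsIrreducible → ProMod p ρ → OrdParallel p ρ →
          ρ.IsResiduallyAbsIrreducible → ¬ EnormousRegime p ρ → ResOrdOccurs p ρ → OrdProMod p ρ := by
  sorry

/-- **Stub S6 `stub_classicalOfOrdinaryPoint` — `C⁺ ⟹ classical` (the card's `ClassicalOfOrdinaryPoint`;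
TEXTUALLY IDENTICAL to the stub of the same name registered by the sibling line
`Lines/paskunas-centre-split.lean`, and the shape of `top-degree-exact-control`'s `OrdinaryPointsClassical`,
so ONE proof serves every line; written fully qualified and inline for that reason — it reads
`irreducible → OrdProMod p ρ → OrdParallel p ρ → CruxConclusion p hcpt ι ρ` in this file's vocabulary, see
`stub_classicalOfOrdinaryPoint_iff`).**  For `F` imaginary quadratic, `p` odd: an irreducible `ρ` that is
ORDINARILY pro-modular of a level maximal above `p` and Galois-ordinary of one parallel weight `k ≥ 2`
(`m > 0`) is classical (a.e.-unramifiedness is implied by the association and is not assumed).  Intended proof: (a) WEIGHT CHARACTER AT THE POINT — the diamond character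
`x ∘ ordDiamondHom_v : T₂(𝒪_v) → ℚ̄_pˣ` of the ordinary point is the DOMINANT arithmetic weight-`k` character
read off `ρ|_{I_v}` (triage r1-2/r1-3: the load-bearing sub-step "WeightCharacterAtX", an abelian
Hecke⇒Galois compatibility with diamonds; companion/anti-dominant ordering possible only when `ρ|_{Γ_{F_v}}`
splits — the statement stays TRUE there (FM), the proof needs the case split); (b) Khare–Thorne derived control
(arXiv:1409.7007 Prop. 6.6, Cor. 6.8, `GL_n` over any number field), EXACT in the top ordinary degree and at a
characteristic-0 point off `Supp H²_{ord}` in degree `q₀ = 1` (sibling card; no torsion-freeness input);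
(c) Eichler–Shimura–Harder / Franke: a cuspidal Bianchi eigenclass of weight `(k,k)` gives an L-algebraic
cuspidal `π` with the Satake dictionary (irreducibility of `ρ` keeps `x` off the boundary/Eisenstein part).
Why it might fail: (a) is unprinted for `Λ`-adic/torsion `𝔪` over an imaginary quadratic field (one place of
`F⁺` above `p`); `p = 3` needs a neat auxiliary level (3-torsion at Hida level `U(1,1)`, triage r1-3).
Mathematically implied by the crux (FM), so never harder than it.  Size L.
Sources: Hida1993Duke, Hida1994AIF, arXiv:1409.7007 §6, arXiv:1812.09999 §5.2, Harder1987, Franke1998,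
SkinnerWiles1999 Prop. 3.7, arXiv:2311.13514. -/
theorem stub_classicalOfOrdinaryPoint : ∀ (F : Type) [Field F] [NumberField F], NumberField.IsTotallyComplex F → Module.finrank ℚ F = 2 → ∀ (p : ℕ) [Fact p.Prime], p ≠ 2 → ∀ (hcpt : Literature.NumberTheory.Automorphic.isCompact_glFiniteIntegralLevel 2 F) (ι : PadicAlgCl p ≃+* ℂ) (ρ : Literature.NumberTheory.GaloisRepresentations.FramedGaloisRep F (PadicAlgCl p) 2), ρ.toGaloisRep.IsIrreducible → (∃ 𝒰 : Literature.NumberTheory.Automorphic.BigHeckeGLn.TameLevel 2 F p, 𝒰.IsMaximalAbove ∧ 𝒰.IsOrdinarilyPadicallyAutomorphic ρ) → (∃ k : ℕ, 2 ≤ k ∧ ∃ m : ℕ, 0 < m ∧ ∀ v : IsDedekindDomain.HeightOneSpectrum (NumberField.RingOfIntegers F), (p : NumberField.RingOfIntegers F) ∈ v.asIdeal → ρ.IsOrdinaryOfWeightAt p v k m) → ∃ π : Literature.NumberTheory.Automorphic.CuspidalAutomorphicRepData 2 F hcpt, π.1.IsLAlgebraic ∧ ∀ᶠ v in Filter.cofinite,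 Summit.Langlands.SatakeFrobCompatibleAt ι π.1 ρ v := by
  sorry

/-- `stub_classicalOfOrdinaryPoint` read in this file's vocabulary (definitional). -/
theorem stub_classicalOfOrdinaryPoint_iff :
    (∀ (F : Type) [Field F] [NumberField F], NumberField.IsTotallyComplex F → Module.finrank ℚ F = 2 → ∀ (p : ℕ) [Fact p.Prime], p ≠ 2 → ∀ (hcpt : Literature.NumberTheory.Automorphic.isCompact_glFiniteIntegralLevel 2 F) (ι : PadicAlgCl p ≃+* ℂ) (ρ : Literature.NumberTheory.GaloisRepresentations.FramedGaloisRep F (PadicAlgCl p) 2), ρ.toGaloisRep.IsIrreducible → (∃ 𝒰 : Literature.NumberTheory.Automorphic.BigHeckeGLn.TameLevel 2 F p, 𝒰.IsMaximalAbove ∧ 𝒰.IsOrdinarilyPadicallyAutomorphic ρ) → (∃ k : ℕ, 2 ≤ k ∧ ∃ m : ℕ, 0 < m ∧ ∀ v : IsDedekindDomain.HeightOneSpectrum (NumberField.RingOfIntegers F), (p : NumberField.RingOfIntegers F) ∈ v.asIdeal → ρ.IsOrdinaryOfWeightAt p v k m) → ∃ π : Literature.NumberTheory.Automorphic.CuspidalAutomorphicRepData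 2 F hcpt, π.1.IsLAlgebraic ∧ ∀ᶠ v in Filter.cofinite, Summit.Langlands.SatakeFrobCompatibleAt ι π.1 ρ v) ↔
    ∀ (F : Type) [Field F] [NumberField F], IsTotallyComplex F → Module.finrank ℚ F = 2 →
      ∀ (p : ℕ) [Fact p.Prime], p ≠ 2 →
      ∀ (hcpt : isCompact_glFiniteIntegralLevel 2 F) (ι : PadicAlgCl p ≃+* ℂ)
        (ρ : FramedGaloisRep F (PadicAlgCl p) 2),
        ρ.toGaloisRep.IsIrreducible → OrdProMod p ρ → OrdParallel p ρ → CruxConclusion p hcpt ι ρ :=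
  Iff.rfl

/-! ## 3. The composition: stubs ⟹ crux (kernel-checked, no sorry of its own) -/

/-- **The line concludes the crux BY NAME.**  Pure logic: residual ordinary occurrence from S1; case split on
the residual regime — R1: classical ordinary seed (S2) and ACC+ Thm 6.1.2 (S3); R2: ordinary patching with
mod-`p^N` primes (S5) then classicality of ordinary points (S6); R3: the engine run ordinarily / Berger–Klosin
(S4) then S6. -/
theorem ProModularOrdinaryClassical_of
    (h₁ : ∀ (F : Type) [Field F] [NumberField F], IsTotallyComplex F → Module.finrank ℚ F = 2 →
      ∀ (p : ℕ) [Fact p.Prime], p ≠ 2 →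
      ∀ (ρ : FramedGaloisRep F (PadicAlgCl p) 2),
        ρ.toGaloisRep.IsIrreducible → ProMod p ρ → OrdParallel p ρ → ResOrdOccurs p ρ)
    (h₂ : ∀ (F : Type) [Field F] [NumberField F], IsTotallyComplex F → Module.finrank ℚ F = 2 →
      ∀ (p : ℕ) [Fact p.Prime], p ≠ 2 →
      ∀ (hcpt : isCompact_glFiniteIntegralLevel 2 F) (ι : PadicAlgCl p ≃+* ℂ)
        (ρ : FramedGaloisRep F (PadicAlgCl p) 2),
        ρ.toGaloisRep.IsIrreducible → ProMod p ρ → OrdParallel p ρ →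
          EnormousRegime p ρ → ResOrdOccurs p ρ → ClassicalOrdSeed p hcpt ι ρ)
    (h₃ : ∀ (F : Type) [Field F] [NumberField F], IsTotallyComplex F → Module.finrank ℚ F = 2 →
      ∀ (p : ℕ) [Fact p.Prime], p ≠ 2 →
      ∀ (hcpt : isCompact_glFiniteIntegralLevel 2 F) (ι : PadicAlgCl p ≃+* ℂ)
        (ρ : FramedGaloisRep F (PadicAlgCl p) 2),
        ρ.toGaloisRep.IsIrreducible → (∀ᶠ v in cofinite, ρ.IsUnramifiedAt v) → OrdParallel p ρ →
          EnormousRegime p ρ → ClassicalOrdSeed p hcpt ι ρ → CruxConclusion p hcpt ι ρ)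
    (h₄ : ∀ (F : Type) [Field F] [NumberField F], IsTotallyComplex F → Module.finrank ℚ F = 2 →
      ∀ (p : ℕ) [Fact p.Prime], p ≠ 2 →
      ∀ (ρ : FramedGaloisRep F (PadicAlgCl p) 2),
        ρ.toGaloisRep.IsIrreducible → ProMod p ρ → OrdParallel p ρ →
          ¬ ρ.IsResiduallyAbsIrreducible → ResOrdOccurs p ρ → OrdProMod p ρ)
    (h₅ : ∀ (F : Type) [Field F] [NumberField F], IsTotallyComplex F → Module.finrank ℚ F = 2 →
      ∀ (p : ℕ) [Fact p.Prime], p ≠ 2 →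
      ∀ (ρ : FramedGaloisRep F (PadicAlgCl p) 2),
        ρ.toGaloisRep.IsIrreducible → ProMod p ρ → OrdParallel p ρ →
          ρ.IsResiduallyAbsIrreducible → ¬ EnormousRegime p ρ → ResOrdOccurs p ρ → OrdProMod p ρ)
    (h₆ : ∀ (F : Type) [Field F] [NumberField F], IsTotallyComplex F → Module.finrank ℚ F = 2 →
      ∀ (p : ℕ) [Fact p.Prime], p ≠ 2 →
      ∀ (hcpt : isCompact_glFiniteIntegralLevel 2 F) (ι : PadicAlgCl p ≃+* ℂ)
        (ρ : FramedGaloisRep F (PadicAlgCl p) 2),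
        ρ.toGaloisRep.IsIrreducible → OrdProMod p ρ → OrdParallel p ρ → CruxConclusion p hcpt ι ρ) :
    Summit.Langlands.Langlands.Theses.SkinnerWilesDefectOne.ProModularOrdinaryClassical := by
  refine crux_iff.mpr ?_
  intro F _ _ hF hdeg p _ hp hcpt ι ρ hirr hunr hpm hord
  -- S1: the residual eigensystem occurs in Hida's ordinary completed cohomology
  have hRO : ResOrdOccurs p ρ := h₁ F hF hdeg p hp ρ hirr hpm hord
  by_cases hres : ρ.IsResiduallyAbsIrreducible
  · by_cases hR1 : EnormousRegime p ρ
    · -- R1: classical ordinary seed, then ACC+ Thm 6.1.2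
      exact h₃ F hF hdeg p hp hcpt ι ρ hirr hunr hord hR1
        (h₂ F hF hdeg p hp hcpt ι ρ hirr hpm hord hR1 hRO)
    · -- R2: ordinary patching with mod-p^N Taylor–Wiles primes, then classicality of ordinary points
      exact h₆ F hF hdeg p hp hcpt ι ρ hirr (h₅ F hF hdeg p hp ρ hirr hpm hord hres hR1 hRO) hord
  · -- R3: the engine run ordinarily / Berger–Klosin, then classicality of ordinary points
    exact h₆ F hF hdeg p hp hcpt ι ρ hirr (h₄ F hF hdeg p hp ρ hirr hpm hord hres hRO) hord

/-- The crux from the six registered stubs (the only sorries are inside `stub_*`). -/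
theorem ProModularOrdinaryClassical_proof :
    Summit.Langlands.Langlands.Theses.SkinnerWilesDefectOne.ProModularOrdinaryClassical :=
  ProModularOrdinaryClassical_of stub_ordinaryOccurrence stub_classicalOrdinarySeed stub_enormousOrdinaryLift
    stub_reducibleRegimeFactorisation stub_smallImageFactorisation stub_classicalOfOrdinaryPoint

end

end Summit.Langlands.Langlands.Cruxes.ProModularOrdinaryClassical.OrdinaryPatchingByRegime
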